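import Mathlib
import Summits.SmoothPoincare4.SmoothPoincare4.Cruxes.CylinderRungTwo.IdeateSketchK3
import Summits.SmoothPoincare4.SmoothPoincare4.Cruxes.CylinderRungTwo.IdeateSketchK1
import Literature.Geometry.Riemannian.SphericalCylinderEntropy

/-!
# Crux-triage r1 / triager 2 (file TriageR1K2Lemmas.lean) — machine-checked findings on the first lemmas of the ideas for
`CylinderRungTwo` (stmt-SmoothPoincare4-7631)

* `entropyDominatesAreaRatio` : ideator 3's first lemma **A1** (`EntropyDominatesAreaRatio`, card
  `ground-state-relaxation`) is PROVED — it is the tree theorem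
  `Literature.Geometry.Riemannian.SphericalCylinderEntropy.measure_ratio_le_cylEntropy` restricted to compact sets.
* `uniqueSeparatingSheet` : ideator 3's first lemma **B1** (`UniqueSeparatingSheet`, card
  `separating-sheet-genealogy`) is PROVED from the tree's area floor for separating sets + A1
  (no manifold structure is needed: two disjoint separating pieces carry `2·μH⁴(S⁴)`).
* `fluxIdentity_false` : ideator 1's first lemma **`FluxIdentity`** (card `killing-flux`) is FALSE AS TYPED:
  witness `M = S⁴ ⊔ S⁴` embedded as the two slices `{z₅ = 0} ∪ {z₅ = 1}` (tree `twoSlices`) with the defining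
  function `f(z) = z₅ (z₅ - 1)` (positive at the upper end, as required — but ALSO at the lower end, which
  `IsDefiningFunction` does not forbid): the unit normal is `-e₅` on the lower slice and `+e₅` on the upper one,
  so the flux is `-vol(S⁴) + vol(S⁴) = 0 ≠ vol(S⁴)`.  Repair: add `ConnectedSpace M` (the crux has `M ≃ₕ S⁴`) or
  require `f < 0` at the lower end in `IsDefiningFunction`.
-/

set_option linter.dupNamespace false

open scoped BigOperators Manifold ContDiff ENNReal Topology
open MeasureTheory Set
open Literature.Geometry.Riemannian.SphericalCylinderEntropy
open Literature.Geometry.Manifold.CylinderSlice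

namespace Summit.SmoothPoincare4.SmoothPoincare4.Cruxes.CylinderRungTwo.Triage2

open Summit.SmoothPoincare4.SmoothPoincare4.Cruxes.CylinderRungTwo.Ideator3

/-- Ideator 3's `cylEnt` is literally the tree's `cylEntropy` (both are the route items' inline `⨆`). -/
theorem cylEnt_eq (A : Set E6) : cylEnt A = cylEntropy A := rfl

/-- A compact subset of `ℝ⁶` has bounded height `|z₅|`. -/
theorem exists_height_bound {A : Set E6} (hA : IsCompact A) : ∃ B : ℝ, ∀ z ∈ A, |z 5| ≤ B := by
  obtain ⟨B, hB⟩ := (hA.image (EuclideanSpace.proj (5 : Fin 6)).continuous.abs).bddAbove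
  exact ⟨B, fun z hz => hB ⟨z, hz, rfl⟩⟩

/-- **A1 proved.** -/
theorem entropyDominatesAreaRatio : EntropyDominatesAreaRatio := by
  intro A hAN hA
  obtain ⟨B, hB⟩ := exists_height_bound hA
  rw [cylEnt_eq]
  exact measure_ratio_le_cylEntropy hA.isClosed.measurableSet (fun z hz => hAN hz) hB

/-- **B1 proved.** Below cylinder entropy `2` at most one clopen piece of a closed embedded
hypersurface of `N` separates the ends. -/
theorem uniqueSeparatingSheet : UniqueSeparatingSheet := by
  intro M _ _ _ _ _ _ ι hι hN hent A B hA hB hAB hsA hsB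
  have hcont : Continuous ι := hι.isEmbedding.continuous
  have hinj : Function.Injective ι := hι.isEmbedding.injective
  -- measurability of the pieces and of the range
  have hAm : MeasurableSet (ι '' A) := ((hA.isClosed.isCompact).image hcont).isClosed.measurableSet
  have hBm : MeasurableSet (ι '' B) := ((hB.isClosed.isCompact).image hcont).isClosed.measurableSet
  have hRc : IsCompact (Set.range ι) := isCompact_range hcont
  -- area floor on each separating piece
  obtain ⟨RA, hRA⟩ := hsA
  obtain ⟨RB, hRB⟩ := hsB
  have hfA : μH[4] (Metric.sphere (0 : EuclideanSpace ℝ (Fin 5)) 1) ≤ μH[4] (ι '' A) :=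
    hausdorffMeasure_sphere_le_of_separatesEnds (A := ι '' A) (R := RA)
      (fun a b ha hb h1 h2 => hRA a b ha hb h1 h2)
  have hfB : μH[4] (Metric.sphere (0 : EuclideanSpace ℝ (Fin 5)) 1) ≤ μH[4] (ι '' B) :=
    hausdorffMeasure_sphere_le_of_separatesEnds (A := ι '' B) (R := RB)
      (fun a b ha hb h1 h2 => hRB a b ha hb h1 h2)
  -- the two pieces are disjoint and sit inside the range
  have hdisj : Disjoint (ι '' A) (ι '' B) := (Set.disjoint_image_iff hinj).2 hAB
  have hsub : ι '' A ∪ ι '' B ⊆ Set.range ι := by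
    rintro z (⟨x, -, rfl⟩ | ⟨x, -, rfl⟩) <;> exact ⟨x, rfl⟩
  set S := μH[4] (Metric.sphere (0 : EuclideanSpace ℝ (Fin 5)) 1) with hS
  have hS0 : S ≠ 0 := hausdorffMeasure_sphere_four_pos.ne'
  have hStop : S ≠ ⊤ := hausdorffMeasure_sphere_four_lt_top.ne
  have htwo : S + S ≤ μH[4] (Set.range ι) := by
    calc S + S ≤ μH[4] (ι '' A) + μH[4] (ι '' B) := add_le_add hfA hfB
      _ = μH[4] (ι '' A ∪ ι '' B) := (measure_union hdisj hBm).symm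
      _ ≤ μH[4] (Set.range ι) := measure_mono hsub
  -- A1 on the range
  obtain ⟨Bd, hBd⟩ := exists_height_bound hRc
  have hA1 : S⁻¹ * μH[4] (Set.range ι) ≤ cylEntropy (Set.range ι) :=
    measure_ratio_le_cylEntropy hRc.isClosed.measurableSet
      (by rintro _ ⟨x, rfl⟩; exact hN x) hBd
  have h2 : (2 : ℝ≥0∞) ≤ S⁻¹ * μH[4] (Set.range ι) := by
    calc (2 : ℝ≥0∞) = S⁻¹ * (S + S) := by
          rw [mul_add, ENNReal.inv_mul_cancel hS0 hStop]; norm_num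
      _ ≤ S⁻¹ * μH[4] (Set.range ι) := by gcongr
  rw [cylEnt_eq] at hent
  exact absurd (h2.trans hA1) (not_le.2 hent)

/-! ## `FluxIdentity` (card `killing-flux`) is false as typed -/

section Flux

/-- The defining function `f(z) = z₅ (z₅ - 1)` of the two-slice configuration. -/
def f5 : EuclideanSpace ℝ (Fin 6) → ℝ := fun z => z 5 * (z 5 - 1)

theorem contDiff_f5 : ContDiff ℝ ∞ f5 := by
  have hp : ContDiff ℝ ∞ (fun z : EuclideanSpace ℝ (Fin 6) => z 5) :=
    (EuclideanSpace.proj (𝕜 := ℝ) (5 : Fin 6)).contDiff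
  exact hp.mul (hp.sub contDiff_const)

theorem hasGradientAt_f5 (z : EuclideanSpace ℝ (Fin 6)) :
    HasGradientAt f5 ((2 * z 5 - 1) • Sketch.axis) z := by
  rw [hasGradientAt_iff_hasFDerivAt]
  have hp : HasFDerivAt (fun z : EuclideanSpace ℝ (Fin 6) => z 5)
      (EuclideanSpace.proj (𝕜 := ℝ) (5 : Fin 6)) z :=
    (EuclideanSpace.proj (𝕜 := ℝ) (5 : Fin 6)).hasFDerivAt
  refine (hp.mul (hp.sub_const 1)).congr_fderiv ?_
  ext v
  simp [InnerProductSpace.toDual_apply_apply, Sketch.axis, EuclideanSpace.inner_single_left]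
  ring

theorem gradN_f5 (z : EuclideanSpace ℝ (Fin 6)) : Sketch.gradN f5 z = (2 * z 5 - 1) • Sketch.axis := by
  rw [Sketch.gradN, (hasGradientAt_f5 z).gradient]
  have h0 : inner ℝ ((2 * z 5 - 1) • Sketch.axis) (Sketch.base z) = 0 := by
    simp [Sketch.base, Sketch.axis, inner_sub_right, real_inner_smul_left, real_inner_smul_right,
      EuclideanSpace.inner_single_left]
    ring
  rw [h0, zero_smul, sub_zero]

theorem inner_axis_unitNormalN_f5 (z : EuclideanSpace ℝ (Fin 6)) :
    inner ℝ Sketch.axis (Sketch.unitNormalN f5 z) = |2 * z 5 - 1|⁻¹ * (2 * z 5 - 1) := by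
  rw [Sketch.unitNormalN, gradN_f5, norm_smul, real_inner_smul_right, real_inner_smul_right]
  have h1 : ‖(Sketch.axis : EuclideanSpace ℝ (Fin 6))‖ = 1 := by
    simp [Sketch.axis]
  have h2 : inner ℝ (Sketch.axis : EuclideanSpace ℝ (Fin 6)) Sketch.axis = 1 := by
    simp [Sketch.axis]
  rw [h1, h2, Real.norm_eq_abs, mul_one, mul_one]

theorem isDefiningFunction_f5 : Sketch.IsDefiningFunction twoSlices f5 := by
  refine ⟨contDiff_f5, ?_, ?_, ⟨2, ?_⟩⟩
  · intro z hz
    have hz' : ∑ i : Fin 5, z (Fin.castSucc i) ^ 2 = 1 := hz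
    rw [range_twoSlices]
    simp only [f5, mul_eq_zero, sub_eq_zero, Set.mem_union, Set.mem_setOf_eq]
    tauto
  · intro x
    rw [gradN_f5]
    rcases x with x | x <;> norm_num [twoSlices, Sketch.axis]
  · intro z _ hz
    show 0 < z 5 * (z 5 - 1)
    nlinarith

/-- **`FluxIdentity` is false as typed** (two-slice witness, see the module docstring). -/
theorem fluxIdentity_false : ¬ Sketch.FluxIdentity := by
  intro h
  have key := h ((Metric.sphere (0 : EuclideanSpace ℝ (Fin 5)) 1) ⊕
      (Metric.sphere (0 : EuclideanSpace ℝ (Fin 5)) 1)) twoSlices isSmoothEmbedding_twoSlices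
    sum_sq_twoSlices
    (separatesEnds_of_slice_subset (c := 0) (by rw [range_twoSlices]; exact Set.subset_union_left))
    f5 isDefiningFunction_f5
  -- split the integral over the two slices
  have hsplit : Set.range twoSlices = Set.range (sliceMap 0) ∪ Set.range (sliceMap 1) := by
    rw [twoSlices, Set.Sum.elim_range]
  have hdisj : Disjoint (Set.range (sliceMap 0)) (Set.range (sliceMap 1)) := by
    rw [Set.disjoint_iff]
    rintro z ⟨⟨x, rfl⟩, ⟨y, hy⟩⟩
    have h5 := congrArg (fun z : EuclideanSpace ℝ (Fin 6) => z 5) hy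
    simp only [sliceMap_apply_last] at h5
    exact one_ne_zero h5
  set S := μH[4] (Metric.sphere (0 : EuclideanSpace ℝ (Fin 5)) 1) with hS
  have hS0 : S ≠ 0 := hausdorffMeasure_sphere_four_pos.ne'
  have hStop : S ≠ ⊤ := hausdorffMeasure_sphere_four_lt_top.ne
  have hm0 : μH[4] (Set.range (sliceMap 0)) = S := hausdorffMeasure_range_sliceMap 0
  have hm1 : μH[4] (Set.range (sliceMap 1)) = S := hausdorffMeasure_range_sliceMap 1
  -- the integrand is `-1` on the lower slice and `+1` on the upper slice
  have hlow : EqOn (fun z => inner ℝ Sketch.axis (Sketch.unitNormalN f5 z)) (fun _ => (-1 : ℝ))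
      (Set.range (sliceMap 0)) := by
    rintro _ ⟨x, rfl⟩
    simp only [inner_axis_unitNormalN_f5, sliceMap_apply_last]
    norm_num
  have hup : EqOn (fun z => inner ℝ Sketch.axis (Sketch.unitNormalN f5 z)) (fun _ => (1 : ℝ))
      (Set.range (sliceMap 1)) := by
    rintro _ ⟨x, rfl⟩
    simp only [inner_axis_unitNormalN_f5, sliceMap_apply_last]
    norm_num
  have hint0 : IntegrableOn (fun z => inner ℝ Sketch.axis (Sketch.unitNormalN f5 z)) (Set.range (sliceMap 0)) μH[4] :=
    (integrableOn_const (by rw [hm0]; exact hStop)).congr_fun hlow.symm (measurableSet_range_sliceMap 0)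
  have hint1 : IntegrableOn (fun z => inner ℝ Sketch.axis (Sketch.unitNormalN f5 z)) (Set.range (sliceMap 1)) μH[4] :=
    (integrableOn_const (by rw [hm1]; exact hStop)).congr_fun hup.symm (measurableSet_range_sliceMap 1)
  rw [hsplit, setIntegral_union hdisj (measurableSet_range_sliceMap 1) hint0 hint1,
    setIntegral_congr_fun (measurableSet_range_sliceMap 0) hlow,
    setIntegral_congr_fun (measurableSet_range_sliceMap 1) hup,
    setIntegral_const, setIntegral_const, measureReal_def, measureReal_def, hm0, hm1] at key
  -- key : S.toReal • (-1) + S.toReal • 1 = S.toReal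
  have hpos : 0 < S.toReal := ENNReal.toReal_pos hS0 hStop
  simp only [smul_eq_mul] at key
  linarith

end Flux

end Summit.SmoothPoincare4.SmoothPoincare4.Cruxes.CylinderRungTwo.Triage2
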